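import Mathlib.Analysis.SpecialFunctions.Pow.Real
import Mathlib.Algebra.Order.BigOperators.Group.Finset
import Mathlib.Algebra.BigOperators.Ring.Finset
import HarnessLib

/-!
# GridStability/Lyapunov/TreePoincare — a tree Poincaré inequality: coercivity of a network's
# Laplacian form from a spanning tree, with NO matrix certificate

Cell `gridfusion` (LADDER-GRIDFUSION), `plan/PARTITION.md` A25 route (b) «printed P» (lead
2026-08-27T01:16:41Z (2)); seat gridfusion-lyap-1 (g3); namespace
`Summit.Ventures.GridStability.Lyapunov.TreePoincare`. PURPOSE: lit-1's existence theorem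
`ClassicalModel.exists_equilibrium_of_residual_reference` (p481514, DLC 2015 Cor. 1 + BV (9.11))
asks for the COERCIVITY hypothesis `μ Σ_i v_i² ≤ c₀ · ½ Σ_i Σ_j C_ij (v_i − v_j)²` for all `v`
vanishing at the reference node. The suggested discharge was a `49 × 49` exact PSD certificate
(`c₀·L(C) − μ·I + κ·e_r e_rᵀ ⪰ 0`, LDLᵀ pivots of ≈ 1500 digits). This file proves the hypothesis
COMBINATORIALLY from any rooted spanning tree of the coupling graph given as a parent array with
depths (exactly the data model-2's instance files already carry for connectivity), with the explicit
constant `μ = c₀ · β / (2 · Σ_i depth_i)` (`β` a lower bound of the couplings on the tree edges):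

* `sq_le_depth_mul_pathSum` — for `v` with `v root = 0`: `v_i² ≤ depth_i · Σ_{k < depth_i}
  (v(p^k i) − v(p^{k+1} i))²` (telescoping along the path to the root + Cauchy–Schwarz, by
  induction on the depth with `(a + b)² ≤ (d+1)·a² + (1 + 1/d)·b²`);
* `pathSum_le_treeSum` — the path terms are distinct tree edges (depth drops by one per step), so
  each path sum is at most `T(v) := Σ_{j ≠ root} (v_j − v_{parent j})²`;
* `sum_sq_le_sumDepth_mul_treeSum` — `Σ_i v_i² ≤ (Σ_i depth_i) · T(v)`;
* `treeSum_le_laplacianForm` — `β · T(v) ≤ Σ_i Σ_j C_ij (v_i − v_j)²` when `C ≥ 0` and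
  `β ≤ C_{j, parent j}` on tree edges (one orientation of each tree edge inside the double sum);
* `coercivity_of_spanningTree` — the lit-1-shaped conclusion
  `μ Σ_i v_i² ≤ c₀ · (½ Σ_i Σ_j C_ij (v_i − v_j)²)` with `μ = c₀ β / (2 Σ_i depth_i)`, `c₀ ≥ 0`.

For the NE39-SP data (BFS tree from G1, `Σ depth = 338`, `β = 5200202273/312500000`,
`c₀ = 459451/500000`) this gives `μ ≈ 0.0226`, and with `R = 2·10⁻⁶` the residual condition
`4Σres² ≈ 3.1·10⁻¹⁶ < μ²R² ≈ 2.0·10⁻¹⁵` of the existence theorem holds — numbers for the route-(b)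
file, not used here. Pure real analysis; no definition, no named fact, standard axioms.
-/

noncomputable section

open Finset

namespace Summit.Ventures.GridStability.Lyapunov.TreePoincare

variable {n : ℕ}

section Tree

variable (parent : Fin n → Fin n) (depth : Fin n → ℕ) (root : Fin n)

/-- Along a parent-pointer tree whose depth drops by one per step, `k ≤ depth i` steps up from `i`
land at depth `depth i − k`. [folklore] -/
theorem depth_iterate (hroot : depth root = 0)
    (hdepth : ∀ i, i ≠ root → depth (parent i) + 1 = depth i) :
    ∀ (k : ℕ) (i : Fin n), k ≤ depth i → depth (parent^[k] i) + k = depth i := by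
  intro k
  induction k with
  | zero => intro i _; simp
  | succ k ih =>
    intro i hk
    have hi : i ≠ root := by
      rintro rfl; rw [hroot] at hk; exact Nat.not_succ_le_zero k hk
    have hd := hdepth i hi
    have hk' : k ≤ depth (parent i) := by omega
    have h := ih (parent i) hk'
    rw [Function.iterate_succ_apply]
    omega

/-- The nodes on the path strictly below the root are not the root. [folklore] -/
theorem iterate_ne_root (hroot : depth root = 0)
    (hdepth : ∀ i, i ≠ root → depth (parent i) + 1 = depth i)
    {k : ℕ} {i : Fin n} (hk : k < depth i) : parent^[k] i ≠ root := by
  intro h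
  have hd := depth_iterate parent depth root hroot hdepth k i hk.le
  rw [h, hroot] at hd
  omega

/-- The path nodes `p^k i`, `k < depth i`, are pairwise distinct (their depths differ). [folklore] -/
theorem iterate_injOn (hroot : depth root = 0)
    (hdepth : ∀ i, i ≠ root → depth (parent i) + 1 = depth i) (i : Fin n) :
    Set.InjOn (fun k => parent^[k] i) (range (depth i) : Finset ℕ) := by
  intro k hk l hl hkl
  simp only [coe_range, Set.mem_Iio] at hk hl
  have h1 := depth_iterate parent depth root hroot hdepth k i hk.le
  have h2 := depth_iterate parent depth root hroot hdepth l i hl.le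
  simp only at hkl
  rw [hkl] at h1
  omega

/-- One step of the path sum: split off the first edge. [folklore] -/
theorem pathSum_succ (v : Fin n → ℝ) (i : Fin n) (d : ℕ) :
    ∑ k ∈ range (d + 1), (v (parent^[k] i) - v (parent^[k + 1] i)) ^ 2
      = (v i - v (parent i)) ^ 2
        + ∑ k ∈ range d, (v (parent^[k] (parent i)) - v (parent^[k + 1] (parent i))) ^ 2 := by
  rw [sum_range_succ' (fun k => (v (parent^[k] i) - v (parent^[k + 1] i)) ^ 2) d]
  simp only [Function.iterate_succ_apply, Function.iterate_zero_apply]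
  ring

/-- **Path estimate**: for `v` vanishing at the root,
`v_i² ≤ depth_i · Σ_{k < depth_i} (v(p^k i) − v(p^{k+1} i))²` (telescoping + Cauchy–Schwarz, by
induction on the depth). [folklore] -/
theorem sq_le_depth_mul_pathSum (hroot : depth root = 0)
    (hdepth : ∀ i, i ≠ root → depth (parent i) + 1 = depth i) (v : Fin n → ℝ) (hv : v root = 0) :
    ∀ (d : ℕ) (i : Fin n), depth i = d →
      v i ^ 2 ≤ (d : ℝ) * ∑ k ∈ range d, (v (parent^[k] i) - v (parent^[k + 1] i)) ^ 2 := by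
  intro d
  induction d with
  | zero =>
    intro i hi
    -- depth 0: `i` is the root
    have : i = root := by
      by_contra h
      have := hdepth i h
      omega
    subst this
    simp [hv]
  | succ d ih =>
    intro i hi
    have hne : i ≠ root := by rintro rfl; rw [hroot] at hi; exact Nat.succ_ne_zero d hi.symm
    have hpd : depth (parent i) = d := by have := hdepth i hne; omega
    have hIH := ih (parent i) hpd
    rw [pathSum_succ parent v i d]
    set a : ℝ := v i - v (parent i) with ha
    set b : ℝ := v (parent i) with hb
    set S : ℝ := ∑ k ∈ range d, (v (parent^[k] (parent i)) - v (parent^[k + 1] (parent i))) ^ 2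
      with hS
    have hS0 : 0 ≤ S := sum_nonneg fun k _ => sq_nonneg _
    have hvi : v i = a + b := by rw [ha, hb]; ring
    have hd0 : (0 : ℝ) ≤ d := Nat.cast_nonneg d
    rw [hvi]
    push_cast
    rcases Nat.eq_zero_or_pos d with hd | hd
    · -- the parent is the root: `b = 0`
      subst hd
      have hb0 : b = 0 := by
        have : b ^ 2 ≤ 0 := by simpa using hIH
        nlinarith [sq_nonneg b]
      rw [hb0]
      simp only [add_zero, Nat.cast_zero, zero_add, one_mul]
      linarith
    · -- `d·[(d+1)(a²+S) − (a+b)²] = (d a − b)² + (d+1)(d S − b²) ≥ 0`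
      have hdr : (0 : ℝ) < d := by exact_mod_cast hd
      have hkey : (d : ℝ) * (((d : ℝ) + 1) * (a ^ 2 + S) - (a + b) ^ 2)
          = ((d : ℝ) * a - b) ^ 2 + ((d : ℝ) + 1) * ((d : ℝ) * S - b ^ 2) := by ring
      have hnn : 0 ≤ (d : ℝ) * (((d : ℝ) + 1) * (a ^ 2 + S) - (a + b) ^ 2) := by
        rw [hkey]
        have : 0 ≤ (d : ℝ) * S - b ^ 2 := by linarith
        positivity
      have := (mul_nonneg_iff_of_pos_left hdr).1 hnn
      linarith

/-- **Each path sum is at most the tree sum** `T(v) = Σ_{j ≠ root} (v_j − v_{parent j})²` (the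
path edges are distinct non-root nodes paired with their parents). [folklore] -/
theorem pathSum_le_treeSum (hroot : depth root = 0)
    (hdepth : ∀ i, i ≠ root → depth (parent i) + 1 = depth i) (v : Fin n → ℝ) (i : Fin n) :
    ∑ k ∈ range (depth i), (v (parent^[k] i) - v (parent^[k + 1] i)) ^ 2
      ≤ ∑ j ∈ univ.erase root, (v j - v (parent j)) ^ 2 := by
  classical
  have hinj := iterate_injOn parent depth root hroot hdepth i
  have hre : ∑ k ∈ range (depth i), (v (parent^[k] i) - v (parent^[k + 1] i)) ^ 2
      = ∑ k ∈ range (depth i), (v (parent^[k] i) - v (parent (parent^[k] i))) ^ 2 := by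
    refine sum_congr rfl fun k _ => ?_
    simp only [Function.iterate_succ_apply']
  have himg : ∑ j ∈ (range (depth i)).image (fun k => parent^[k] i), (v j - v (parent j)) ^ 2
      = ∑ k ∈ range (depth i), (v (parent^[k] i) - v (parent (parent^[k] i))) ^ 2 :=
    sum_image fun x hx y hy h => hinj hx hy h
  rw [hre, ← himg]
  refine sum_le_sum_of_subset_of_nonneg ?_ fun j _ _ => sq_nonneg _
  intro j hj
  rw [mem_image] at hj
  obtain ⟨k, hk, rfl⟩ := hj
  rw [mem_range] at hk
  exact mem_erase.2 ⟨iterate_ne_root parent depth root hroot hdepth hk, mem_univ _⟩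

/-- **Tree Poincaré inequality**: `Σ_i v_i² ≤ (Σ_i depth_i) · Σ_{j ≠ root} (v_j − v_{parent j})²`
for every `v` with `v root = 0`. [folklore] -/
theorem sum_sq_le_sumDepth_mul_treeSum (hroot : depth root = 0)
    (hdepth : ∀ i, i ≠ root → depth (parent i) + 1 = depth i) (v : Fin n → ℝ) (hv : v root = 0) :
    ∑ i, v i ^ 2 ≤ (∑ i, (depth i : ℝ)) * ∑ j ∈ univ.erase root, (v j - v (parent j)) ^ 2 := by
  set T := ∑ j ∈ univ.erase root, (v j - v (parent j)) ^ 2 with hT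
  have hT0 : 0 ≤ T := sum_nonneg fun j _ => sq_nonneg _
  rw [sum_mul]
  refine sum_le_sum fun i _ => ?_
  have h1 := sq_le_depth_mul_pathSum parent depth root hroot hdepth v hv (depth i) i rfl
  have h2 := pathSum_le_treeSum parent depth root hroot hdepth v i
  exact h1.trans (mul_le_mul_of_nonneg_left h2 (Nat.cast_nonneg _))

/-- **The tree sum is dominated by the Laplacian form**: with couplings `C ≥ 0` and
`β ≤ C_{j, parent j}` on the tree edges, `β · T(v) ≤ Σ_i Σ_j C_ij (v_i − v_j)²` (the tree edges
in one orientation form a sub-family of the ordered pairs). [folklore] -/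
theorem treeSum_le_laplacianForm (C : Fin n → Fin n → ℝ) (hC0 : ∀ i j, 0 ≤ C i j)
    {β : ℝ} (hβC : ∀ j, j ≠ root → β ≤ C j (parent j)) (v : Fin n → ℝ) :
    β * ∑ j ∈ univ.erase root, (v j - v (parent j)) ^ 2
      ≤ ∑ i, ∑ j, C i j * (v i - v j) ^ 2 := by
  rw [mul_sum]
  calc ∑ j ∈ univ.erase root, β * (v j - v (parent j)) ^ 2
      ≤ ∑ j ∈ univ.erase root, C j (parent j) * (v j - v (parent j)) ^ 2 :=
        sum_le_sum fun j hj =>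
          mul_le_mul_of_nonneg_right (hβC j (ne_of_mem_erase hj)) (sq_nonneg _)
    _ ≤ ∑ j, C j (parent j) * (v j - v (parent j)) ^ 2 :=
        sum_le_sum_of_subset_of_nonneg (erase_subset _ _)
          fun j _ _ => mul_nonneg (hC0 _ _) (sq_nonneg _)
    _ ≤ ∑ i, ∑ j, C i j * (v i - v j) ^ 2 :=
        sum_le_sum fun i _ =>
          single_le_sum (f := fun j => C i j * (v i - v j) ^ 2)
            (fun j _ => mul_nonneg (hC0 _ _) (sq_nonneg _)) (mem_univ (parent i))

/-- **Coercivity from a spanning tree (the hypothesis `hcoer` of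
`ClassicalModel.exists_equilibrium_of_residual_reference`)**: for couplings `C ≥ 0`, a rooted
spanning tree of the coupling graph as a parent array with depths (`depth root = 0`,
`depth (parent j) + 1 = depth j`), a tree-edge floor `0 < β ≤ C_{j, parent j}`, and `c₀ ≥ 0`:
every `v` with `v root = 0` satisfies `μ Σ_i v_i² ≤ c₀ · (½ Σ_i Σ_j C_ij (v_i − v_j)²)` with
`μ = c₀ β / (2 Σ_i depth_i)`. No eigenvalue, no matrix certificate. [folklore] -/
theorem coercivity_of_spanningTree (C : Fin n → Fin n → ℝ) (hC0 : ∀ i j, 0 ≤ C i j)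
    (hroot : depth root = 0) (hdepth : ∀ i, i ≠ root → depth (parent i) + 1 = depth i)
    {β : ℝ} (hβ : 0 < β) (hβC : ∀ j, j ≠ root → β ≤ C j (parent j)) {c₀ : ℝ} (hc₀ : 0 ≤ c₀)
    (hD : 0 < ∑ i, (depth i : ℝ)) (v : Fin n → ℝ) (hv : v root = 0) :
    c₀ * β / (2 * ∑ i, (depth i : ℝ)) * ∑ i, v i ^ 2
      ≤ c₀ * (1 / 2 * ∑ i, ∑ j, C i j * (v i - v j) ^ 2) := by
  have h1 := sum_sq_le_sumDepth_mul_treeSum parent depth root hroot hdepth v hv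
  have h2 := treeSum_le_laplacianForm parent root C hC0 hβC v
  set D := ∑ i, (depth i : ℝ) with hDdef
  set T := ∑ j ∈ univ.erase root, (v j - v (parent j)) ^ 2
  set Q := ∑ i, ∑ j, C i j * (v i - v j) ^ 2
  have hT0 : 0 ≤ T := sum_nonneg fun j _ => sq_nonneg _
  -- `Σ v² ≤ D·T`, `β T ≤ Q` ⇒ `(c₀β/(2D)) Σ v² ≤ (c₀β/(2D))·D·T = c₀ (β T)/2 ≤ c₀ Q/2`
  have h3 : c₀ * β / (2 * D) * ∑ i, v i ^ 2 ≤ c₀ * β / (2 * D) * (D * T) :=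
    mul_le_mul_of_nonneg_left h1 (by positivity)
  have h4 : c₀ * β / (2 * D) * (D * T) = c₀ * (β * T) / 2 := by
    field_simp
  rw [h4] at h3
  have h5 : c₀ * (β * T) / 2 ≤ c₀ * (1 / 2 * Q) := by
    have := mul_le_mul_of_nonneg_left h2 hc₀
    linarith
  exact h3.trans h5

end Tree

end Summit.Ventures.GridStability.Lyapunov.TreePoincare

end
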